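import Summits.Ventures.QEC.Census.BZAutAssembly
import HarnessLib

/-!
# `bz_aut` certificates for bivariate-bicycle codes on FLAT indices (the checker's `Fin (ℓm + ℓm)` bitmask world)

Companion of `Census/BZAutAssembly.lean`. A `[[144,12,12]]` kernel-A certificate (P1; items S1.BZD / S7.BZI / 10.BZC)
is emitted and replayed on FLAT indices: qubits `Fin (ℓm + ℓm)`, checks `Fin (ℓm)`, rows as bitmasks, the code being
`D = (rowMatrix n HX, rowMatrix n HZ)` with `rowMatrix 144 bb144HX = BB.bb144.HXFlat` (`Census/BB/BB144Rank.lean`).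
The automorphisms of a `bz_aut` certificate for `QC(A, B)` are the translations of `ℤ_ℓ × ℤ_m`; here they are
transported to flat indices:

* `BB.translateFlat t : Fin (ℓm+ℓm) ≃ Fin (ℓm+ℓm)` (`= qubitIndex ∘ translate t ∘ qubitIndex⁻¹`) and the check map
  `BB.checkTranslateFlat t` (`= checkIndex ∘ (· + t) ∘ checkIndex⁻¹`), both computable (for `decide`d label
  matrices `ρ_t = Ld * (L.submatrix id (translateFlat t)⁻¹)ᵀ`);
* `BB.HXFlat_submatrix_translateFlat` / `BB.HZFlat_submatrix_translateFlat`: they are row-map automorphisms of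
  `HXFlat`, `HZFlat` — obligation O7a is a THEOREM, no permutation / row-image replay;
* `BB.forall_lt_of_bzAut_translateFlat`: `forall_lt_of_bzAut` for any flat CSS code `D` with `D.HX = C.HXFlat`,
  `D.HZ = C.HZFlat`, automorphisms listed as group elements `τ a`;
* `BB.even_hammingNorm_of_flat`: parity on flat indices from the weight-3 side condition `IsBBPoly`;
* `BB.d_eq_of_bzAut_translateFlat_even`: **the `[[144,12,12]]` closer shape** — blocks certified at the even
  threshold `weff` (`= 10`), `IsBBPoly A B`, `Even weff`, a flat `Z`-witness of weight `weff + 2` (`= 12`)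
  ⊢ `C.d = weff + 2`, via type-05's `dZ_eq_of_flat` + `d_eq_dZ`.

HONEST FRAMING: propositional layer only (no certificate is read here); no distance VALUE is asserted.
-/

namespace Summit.Ventures.QEC.Census

open Matrix Finset Module Literature.InformationTheory.QuantumCodes Literature.InformationTheory.Coding
open Literature.InformationTheory.QuantumCodes.BB

namespace BB

variable {ℓ m : ℕ} [NeZero ℓ] [NeZero m]

/-- The translation by `t ∈ ℤ_ℓ × ℤ_m` of both qubit blocks, on FLAT qubit indices (`§index` convention:
`qubitIndex ∘ translate t ∘ qubitIndex⁻¹`). Computable. -/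
def translateFlat (t : Mono ℓ m) : Fin (ℓ * m + ℓ * m) ≃ Fin (ℓ * m + ℓ * m) :=
  (BB.Code.qubitIndex.symm.trans (BB.Code.translate t)).trans BB.Code.qubitIndex

/-- The translation by `t` of the checks, on FLAT check indices (`checkIndex ∘ (· + t) ∘ checkIndex⁻¹`), as a row
MAP (the shape `AutomorphismLabelAction.lean` and a checker use). Computable. -/
def checkTranslateFlat (t : Mono ℓ m) : Fin (ℓ * m) → Fin (ℓ * m) :=
  fun i => BB.Code.checkIndex (BB.Code.checkIndex.symm i + t)

variable (C : BB.Code ℓ m)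

/-- Flat translations are row-map automorphisms of `HXFlat`: `HXFlat (ρ_t i) (σ_t q) = HXFlat i q`. -/
theorem HXFlat_submatrix_translateFlat (t : Mono ℓ m) :
    C.HXFlat.submatrix (checkTranslateFlat t) (translateFlat t) = C.HXFlat := by
  ext i q
  simp [BB.Code.HXFlat_eq_submatrix, checkTranslateFlat, translateFlat, BB.Code.HX_translate]

/-- Flat translations are row-map automorphisms of `HZFlat`. -/
theorem HZFlat_submatrix_translateFlat (t : Mono ℓ m) :
    C.HZFlat.submatrix (checkTranslateFlat t) (translateFlat t) = C.HZFlat := by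
  ext i q
  simp [BB.Code.HZFlat_eq_submatrix, checkTranslateFlat, translateFlat, BB.Code.HZ_translate]

/-- **`bz_aut` for `QC(A, B)` on flat indices.** For any flat CSS code `D` whose check matrices are literally
`HXFlat`, `HZFlat` (the checker's `CSSCode.ofMatrices (rowMatrix n HX) (rowMatrix n HZ) _` after the two index
identities), `forall_lt_of_bzAut` with the automorphisms given as group elements `τ a` (flat translations; no
row-image replay): every non-trivial flat `Z`-logical has weight `> wmax`. -/
theorem forall_lt_of_bzAut_translateFlat {D : CSSCode (Fin (ℓ * m)) (Fin (ℓ * m)) (Fin (ℓ * m + ℓ * m))}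
    (hX : D.HX = C.HXFlat) (hZ : D.HZ = C.HZFlat)
    {k : ℕ} {L Ld : Matrix (Fin k) (Fin (ℓ * m + ℓ * m)) (ZMod 2)}
    (hdual : ∀ j, D.HZ *ᵥ Ld j = 0) (hpair : ∀ i j, Ld j ⬝ᵥ L i = if i = j then 1 else 0)
    (hdec : ∀ z, D.HX *ᵥ z = 0 → ∃ a : Fin k → ZMod 2, z - ∑ i, a i • L i ∈ D.rowSpZ)
    {nb kb jW mm : ℕ} {Gb : Fin nb → Fin kb → Fin (ℓ * m + ℓ * m) → ZMod 2}
    (hrows : ∀ b, D.rowSpZ ≤ Submodule.span (ZMod 2) (Set.range (Gb b)))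
    {W : Fin nb → Fin jW → Fin k → ZMod 2}
    (hW : ∀ b l, ∑ i, W b l i • L i ∈ Submodule.span (ZMod 2) (Set.range (Gb b)))
    {G : Fin nb → Fin mm → Fin kb → Fin (ℓ * m + ℓ * m) → ZMod 2}
    {T : Fin nb → Fin mm → Fin kb → Fin (ℓ * m + ℓ * m)}
    (hsys : ∀ b i j j', G b i j (T b i j') = if j = j' then 1 else 0)
    (hG : ∀ b i j, G b i j ∈ Submodule.span (ZMod 2) (Set.range (Gb b)))
    {t : Fin nb → Fin mm → ℕ} {wmax : ℕ}
    (henum : ∀ b i (a : Fin kb → ZMod 2), 1 ≤ hammingNorm a → hammingNorm a ≤ t b i →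
      hammingNorm (∑ j, a j • G b i j) ≤ wmax → (∑ j, a j • G b i j) ∈ D.rowSpZ)
    (hbound : ∀ b, wmax < bzBound (T b) (t b))
    {A : Type*} (τ : A → Mono ℓ m)
    (hcover : ∀ lam : Fin k → ZMod 2, lam ≠ 0 →
      (∃ b, lam ∈ Submodule.span (ZMod 2) (Set.range (W b))) ∨
        ∃ a b, (Ld * (L.submatrix id (translateFlat (τ a)).symm)ᵀ) *ᵥ lam ∈
          Submodule.span (ZMod 2) (Set.range (W b)))
    {z : Fin (ℓ * m + ℓ * m) → ZMod 2} (hz : D.HX *ᵥ z = 0) (hz' : z ∉ D.rowSpZ) : wmax < hammingNorm z :=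
  forall_lt_of_bzAut D hdual hpair hdec hrows hW hsys hG henum hbound
    (σ := fun a => translateFlat (τ a)) (ρX := fun a => checkTranslateFlat (τ a))
    (ρZ := fun a => checkTranslateFlat (τ a))
    (fun a => by rw [hX]; exact HXFlat_submatrix_translateFlat C (τ a))
    (fun a => by rw [hZ]; exact HZFlat_submatrix_translateFlat C (τ a)) hcover hz hz'

/-- Parity on flat indices: under the printed weight-3 side condition every flat `w` with `HXFlat w = 0` has even
weight (type-12 `BBEvenDistance` transported along `qubitIndex`). -/
theorem even_hammingNorm_of_flat (hA : IsBBPoly C.A) (hB : IsBBPoly C.B)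
    {D : CSSCode (Fin (ℓ * m)) (Fin (ℓ * m)) (Fin (ℓ * m + ℓ * m))} (hX : D.HX = C.HXFlat)
    {w : Fin (ℓ * m + ℓ * m) → ZMod 2} (hw : D.HX *ᵥ w = 0) : Even (hammingNorm w) := by
  rw [hX, BB.Code.HXFlat_mulVec_eq_zero_iff] at hw
  have h := C.even_hammingNorm_of_HX_mulVec_eq_zero (odd_hammingNorm_of_isBBPoly hA)
    (odd_hammingNorm_of_isBBPoly hB) hw
  have hn := hammingNorm_comp_equiv w (BB.Code.qubitIndex (ℓ := ℓ) (m := m)).symm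
  rw [Equiv.symm_symm] at hn
  rwa [hn] at h

/-- **The `[[n, k, d]]` closer for `QC(A, B)` from a ONE-SIDED flat `bz_aut` certificate at the even threshold
`weff = d − 2`** (`[[144,12,12]]`: `weff = 10`, witness weight `12`): blocks certified on the flat code `D`
(`D.HX = HXFlat`, `D.HZ = HZFlat`) with translations as automorphisms (group elements, no row-image replay),
`Even weff`, `IsBBPoly A B` (even weights), a flat `Z`-witness of weight `weff + 2` ⊢ `C.d = weff + 2`
(`d = d^Z` by Lemma 1; `D.dZ = C.css.dZ` by type-05's `dZ_eq_of_flat`). -/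
theorem d_eq_of_bzAut_translateFlat_even (hA : IsBBPoly C.A) (hB : IsBBPoly C.B)
    {D : CSSCode (Fin (ℓ * m)) (Fin (ℓ * m)) (Fin (ℓ * m + ℓ * m))}
    (hX : D.HX = C.HXFlat) (hZ : D.HZ = C.HZFlat)
    {k : ℕ} {L Ld : Matrix (Fin k) (Fin (ℓ * m + ℓ * m)) (ZMod 2)}
    (hdual : ∀ j, D.HZ *ᵥ Ld j = 0) (hpair : ∀ i j, Ld j ⬝ᵥ L i = if i = j then 1 else 0)
    (hdec : ∀ z, D.HX *ᵥ z = 0 → ∃ a : Fin k → ZMod 2, z - ∑ i, a i • L i ∈ D.rowSpZ)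
    {nb kb jW mm : ℕ} {Gb : Fin nb → Fin kb → Fin (ℓ * m + ℓ * m) → ZMod 2}
    (hrows : ∀ b, D.rowSpZ ≤ Submodule.span (ZMod 2) (Set.range (Gb b)))
    {W : Fin nb → Fin jW → Fin k → ZMod 2}
    (hW : ∀ b l, ∑ i, W b l i • L i ∈ Submodule.span (ZMod 2) (Set.range (Gb b)))
    {G : Fin nb → Fin mm → Fin kb → Fin (ℓ * m + ℓ * m) → ZMod 2}
    {T : Fin nb → Fin mm → Fin kb → Fin (ℓ * m + ℓ * m)}
    (hsys : ∀ b i j j', G b i j (T b i j') = if j = j' then 1 else 0)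
    (hG : ∀ b i j, G b i j ∈ Submodule.span (ZMod 2) (Set.range (Gb b)))
    {t : Fin nb → Fin mm → ℕ} {weff : ℕ} (hweff : Even weff)
    (henum : ∀ b i (a : Fin kb → ZMod 2), 1 ≤ hammingNorm a → hammingNorm a ≤ t b i →
      hammingNorm (∑ j, a j • G b i j) ≤ weff → (∑ j, a j • G b i j) ∈ D.rowSpZ)
    (hbound : ∀ b, weff < bzBound (T b) (t b))
    {A : Type*} (τ : A → Mono ℓ m)
    (hcover : ∀ lam : Fin k → ZMod 2, lam ≠ 0 →
      (∃ b, lam ∈ Submodule.span (ZMod 2) (Set.range (W b))) ∨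
        ∃ a b, (Ld * (L.submatrix id (translateFlat (τ a)).symm)ᵀ) *ᵥ lam ∈
          Submodule.span (ZMod 2) (Set.range (W b)))
    {v : Fin (ℓ * m + ℓ * m) → ZMod 2} (hv : D.HX *ᵥ v = 0) (hv' : v ∉ D.rowSpZ)
    (hwt : hammingNorm v = weff + 2) : C.d = weff + 2 := by
  have hall : ∀ z, D.HX *ᵥ z = 0 → z ∉ D.rowSpZ → weff + 1 < hammingNorm z :=
    fun z hz hz' => forall_succ_lt_of_even D (fun w hw => even_hammingNorm_of_flat C hA hB hX hw) hweff
      (fun w hw hw' => forall_lt_of_bzAut_translateFlat C hX hZ hdual hpair hdec hrows hW hsys hG henum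
        hbound τ hcover hw hw') hz hz'
  rw [C.d_eq_dZ, ← C.dZ_eq_of_flat hX hZ]
  exact dZ_eq_succ_of_forall_lt D hv hv' hwt hall

end BB

end Summit.Ventures.QEC.Census
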